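import Summits.HodgeConjecture.HodgeConjecture.Theorems.F0P3cStCharTSHyperbolicSetEigen   -- ★ (F0P2-p02): `mem_hyperbolicSet_iff`, `mul_conjLocal_eq_one_of_not_mem_hyperbolicSet` (regular ∉ Ω ⇒ rational roots unitary)
import Summits.HodgeConjecture.HodgeConjecture.Theorems.F0P3cStCharTSEllCartanCompact      -- ★ (F0P3a-p03): `isCompact_centralizer_iff_not_mem_hyperbolicSet`; brings ★ CartanFields `not_mem_hyperbolicSet_of_isCompact_centralizer`
import Literature.NumberTheory.Rogawski1990.LocalTransfer                                  -- ★ `IsRegularElt` (:= `charpoly.Separable`), `isRegularElt_iff`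
import Mathlib.Algebra.Polynomial.SpecificDegree                                           -- `Polynomial.Monic.irreducible_iff_roots_eq_zero_of_degree_le_three`
import Mathlib.FieldTheory.Separable                                                       -- `Polynomial.separable_prod_X_sub_C_iff`
import HarnessLib

/-!
# R90-TF · S4 «Ch. 13.1–2», (DICT-Σ) §1 — CARD D: THE TYPE SPLIT OF A REGULAR CHARACTERISTIC POLYNOMIAL IN `U(Φ₃)(L⁺_v)` (Rogawski 1990, §3.6 pp. 28–31 «the four
# types of Cartan subgroups»; §12.5 p. 182 «regular hyperbolic set»; §3.1 p. 19 «regular elements»)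

Cell `hodgecm-mathlib`, crux H413 (`stmt-HodgeConjecture-24833`, lane `--supports … --as helper`), route of record `HCCMUnconditional` (no route verbs; count-neutral).
Programme R90-TF, section S4 (base `R90-C131`), dealer K2E2-plan (g8), CARD D «(DICT-Σ) §1» (DEAL 2026-09-05T02:18:05Z, chair VALVE 18); seat K2E4-p11 (g10).
THEOREMS ONLY (no `def`, no instance, no notation, no named-fact hypothesis, no `sorry`); ★-only imports + Mathlib.

## THE MATHEMATICS
`G_v = Gqs L v = U(Φ₃)(L⁺_v)` at a NON-SPLIT finite place `v` of `L⁺` (so the coefficient ring `L ⊗ L⁺_v = L_w` IS A FIELD, ★ `LocalRing.isField_of_smul_eq`), `Ω = hyperbolicSet L v`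
the conjugates of the regular elements of the split torus `M = (cmBorelTriple L 3 v).M`.  For `γ₀ ∈ G_v` REGULAR (`charpoly γ₀` separable) the monic cubic `p = charpoly γ₀ ∈ L_w[X]`
has exactly one of the three shapes
* `p` irreducible (type (3): `Z(γ₀) ≅ K¹` for the cubic field `K = L_w[X]∕(p)`),
* `p = q · (X − u)` with `q` monic irreducible quadratic (type (2): `Z(γ₀) ≅ K¹ × E¹`),
* `p = ∏ₖ (X − uₖ)` with three DISTINCT roots (types (1) and (0)),
(§1 `cubic_shape_of_monic_separable`, pure `Polynomial` algebra over a field: a reducible monic polynomial of degree `2` or `3` has a root —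
`Polynomial.Monic.irreducible_iff_roots_eq_zero_of_degree_le_three` — divide by `X − C u`, repeat on the quadratic cofactor; `Separable` makes the three roots pairwise distinct,
`Polynomial.separable_prod_X_sub_C_iff`).  If moreover `γ₀ ∉ Ω`, EVERY RATIONAL ROOT `u ∈ L_w` of `p` lies on the norm-one torus, `σ(u)·u = 1` (★ «HYP-EIG»
`mul_conjLocal_eq_one_of_not_mem_hyperbolicSet`: an eigenvalue off the norm-one torus conjugates `γ₀` into `M`), which decorates the split into the three NON-hyperbolic types
(§2 `charpoly_shape_of_not_mem_hyperbolicSet`): type (3) cubic ∕ type (2) `q · (X − u)` with `σ(u)u = 1` ∕ type (1) `∏ₖ (X − uₖ)`, `u` injective, `σ(uₖ)uₖ = 1` — the last in the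
EXACT letters `(hu) (hu1) (hchar)` of ★ F3b `R90S4TypeOneMemberPackage.exists_typeOne_memberPackage`, the middle in the letters `(q u hq hq2 hchar)` of the (β ⇒ α) bridge
`R90S4TypeTwoBlockFrameOfCharpoly` (K2E4-p14).  §3 reads the dichotomy on the MEMBERS of a Cartan system `C` whose non-`M` members are compact: a member `T = Z(γ₀) ∈ C` with
`γ₀ ∈ Ω` IS `M` (a compact centraliser never meets `Ω`, ★ S9a `not_mem_hyperbolicSet_of_isCompact_centralizer`), and a member `T = Z(γ₀) ≠ M` has `γ₀ ∉ Ω`.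
These three are §1 of the final (DICT-Σ) assembly `R90S4StableTransportDictCountTOfRecord`: per member `T = Z(γ₀)`, `T = M` ⇒ ★ `exists_memberPackage_of_eq_cmTorus`; else §2's
three shapes ⇒ type (3) ★ `R90S4CubicCartanStableClass` ∕ type (2) bridge + ★ F1″ + CARD A ∕ type (1) ★ F3b + F5b.

## CONTENTS
* §1 `cubic_shape_of_monic_separable` — over any field `K`.
* §2 `isRoot_of_charpoly_eq_mul_X_sub_C`, `isRoot_of_charpoly_eq_prod`, **`charpoly_shape_of_not_mem_hyperbolicSet`** (`v` non-split).
* §3 `not_mem_hyperbolicSet_of_isCompact_centralizer_gqs`, **`eq_M_of_mem_hyperbolicSet_of_mem`**, **`not_mem_hyperbolicSet_of_ne_M`** (any place; no `hns` needed).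

HONEST LABEL: HC_CM is proved only modulo the 7 printed citations (2 remaining named inputs: hLiu418 = stmt-HodgeConjecture-24832, h413 = stmt-HodgeConjecture-24833) until rung 0
closes.  A classification lemma behind (DICT+COUNT-T) behind the OPEN (W-NP); discharges no named input; count-neutral helper.  REL ≠ ★ ≠ BUILT.

## References
* [Rogawski1990] J. D. Rogawski, *Automorphic Representations of Unitary Groups in Three Variables*, Ann. of Math. Stud. 123 (1990), §3.1 p. 19 (regular elements), §3.6
  pp. 28–31 (the Cartan subgroups of `U(3)` and their types), §12.5 pp. 182–184 (the regular hyperbolic set, compact Cartan subgroups).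
-/

set_option autoImplicit false
set_option linter.dupNamespace false

noncomputable section

open NumberField IsDedekindDomain Polynomial Matrix Topology
open scoped MatrixGroups
open Literature.NumberTheory.Rogawski1990 Literature.NumberTheory.Automorphic Literature.NumberTheory.Automorphic.UnitaryGroup
open Summit.HodgeConjecture.HodgeConjecture.Cruxes.H413

namespace Summit.HodgeConjecture.HodgeConjecture.R90.S4

/-! ## §1 The three shapes of a monic separable cubic over a field -/

section Field

variable {K : Type*} [Field K]

/-- **THE THREE SHAPES OF A MONIC SEPARABLE CUBIC OVER A FIELD**: `p` is irreducible, or `p = q · (X − u)` with `q` monic irreducible of degree `2`, or `p = ∏ₖ (X − uₖ)` with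
three pairwise distinct roots `u : Fin 3 → K`.  (A reducible monic polynomial of degree `2` or `3` has a root — `Monic.irreducible_iff_roots_eq_zero_of_degree_le_three`; divide by
`X − C u` (`mul_divByMonic_eq_iff_isRoot`) and repeat on the monic quadratic cofactor; separability of `∏ₖ (X − uₖ)` is injectivity of `u`, `separable_prod_X_sub_C_iff`.)  This is the
case split of [Rogawski1990, §3.6] by the factorisation type of the characteristic polynomial of a regular element. [cite: Rogawski1990, §3.6 pp. 28–31; §3.1 p. 19] -/
theorem cubic_shape_of_monic_separable (p : K[X]) (hp : p.Monic) (hp3 : p.natDegree = 3) (hsep : p.Separable) :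
    Irreducible p ∨ (∃ (q : K[X]) (u : K), Irreducible q ∧ q.Monic ∧ q.natDegree = 2 ∧ p = q * (X - C u)) ∨
      (∃ u : Fin 3 → K, Function.Injective u ∧ p = ∏ k, (X - C (u k))) := by
  by_cases hirr : Irreducible p
  · exact Or.inl hirr
  right
  -- a reducible monic cubic has a root `u`: `p = (X - C u) * q`, `q` monic of degree `2`
  have hroots : p.roots ≠ 0 := fun h => hirr ((hp.irreducible_iff_roots_eq_zero_of_degree_le_three (by omega) hp3.le).2 h)
  obtain ⟨u, hu⟩ := Multiset.exists_mem_of_ne_zero hroots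
  have hroot : p.IsRoot u := (mem_roots hp.ne_zero).1 hu
  set q : K[X] := p /ₘ (X - C u) with hq_def
  have hpq : (X - C u) * q = p := mul_divByMonic_eq_iff_isRoot.2 hroot
  have hqm : q.Monic := (monic_X_sub_C u).of_mul_monic_left (by rw [hpq]; exact hp)
  have hq2 : q.natDegree = 2 := by
    have h := (monic_X_sub_C u).natDegree_mul hqm
    rw [hpq, hp3, natDegree_X_sub_C] at h
    omega
  by_cases hqirr : Irreducible q
  · exact Or.inl ⟨q, u, hqirr, hqm, hq2, by rw [mul_comm, hpq]⟩
  right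
  -- a reducible monic quadratic has a root `u₂`: `q = (X - C u₂) * r`, `r` monic linear, `r = X - C u₃`
  have hqroots : q.roots ≠ 0 := fun h => hqirr ((hqm.irreducible_iff_roots_eq_zero_of_degree_le_three (by omega) (by omega)).2 h)
  obtain ⟨u₂, hu₂⟩ := Multiset.exists_mem_of_ne_zero hqroots
  have hroot₂ : q.IsRoot u₂ := (mem_roots hqm.ne_zero).1 hu₂
  set r : K[X] := q /ₘ (X - C u₂) with hr_def
  have hqr : (X - C u₂) * r = q := mul_divByMonic_eq_iff_isRoot.2 hroot₂
  have hrm : r.Monic := (monic_X_sub_C u₂).of_mul_monic_left (by rw [hqr]; exact hqm)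
  have hr1 : r.natDegree = 1 := by
    have h := (monic_X_sub_C u₂).natDegree_mul hrm
    rw [hqr, hq2, natDegree_X_sub_C] at h
    omega
  have hr : r = X - C (-r.coeff 0) := by
    rw [C_neg, sub_neg_eq_add]
    exact hrm.eq_X_add_C hr1
  have hprod : p = ∏ k, (X - C (![u, u₂, -r.coeff 0] k)) := by
    simp only [Fin.prod_univ_three, Matrix.cons_val_zero, Matrix.cons_val_one, Matrix.cons_val_two, Matrix.head_cons, Matrix.tail_cons]
    rw [← hr, mul_assoc, hqr, hpq]
  have hsep' : (∏ k, (X - C (![u, u₂, -r.coeff 0] k))).Separable := by rwa [hprod] at hsep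
  exact ⟨![u, u₂, -r.coeff 0], separable_prod_X_sub_C_iff.1 hsep', hprod⟩

end Field

/-! ## §2 The type split of a regular non-hyperbolic element of `U(Φ₃)(L⁺_v)`, `v` non-split -/

section Gqs

variable (L : Type) [Field L] [NumberField L] [IsCMField L] (v : HeightOneSpectrum (𝓞 ↥(maximalRealSubfield L)))

variable {L v}

/-- A root read off a factorisation `charpoly γ₀ = q · (X − u)`: `u` is a root. [cite: Rogawski1990, §3.6 pp. 28–31] -/
theorem isRoot_of_charpoly_eq_mul_X_sub_C {γ₀ : Gqs L v} {q : (LocalRing L v)[X]} {u : LocalRing L v} (hchar : γ₀.val.val.charpoly = q * (X - C u)) :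
    γ₀.val.val.charpoly.IsRoot u := by
  rw [IsRoot, hchar, eval_mul, eval_sub, eval_X, eval_C, sub_self, mul_zero]

/-- A root read off a factorisation `charpoly γ₀ = ∏ₖ (X − uₖ)`: every `uₖ` is a root. [cite: Rogawski1990, §3.6 pp. 28–31] -/
theorem isRoot_of_charpoly_eq_prod {γ₀ : Gqs L v} {u : Fin 3 → LocalRing L v} (hchar : γ₀.val.val.charpoly = ∏ k, (X - C (u k))) (k : Fin 3) :
    γ₀.val.val.charpoly.IsRoot (u k) := by
  rw [IsRoot, hchar, eval_prod]
  exact Finset.prod_eq_zero (Finset.mem_univ k) (by rw [eval_sub, eval_X, eval_C, sub_self])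

/-- **THE TYPE SPLIT OF A REGULAR NON-HYPERBOLIC ELEMENT** (`v` non-split).  For `γ₀ ∈ G_v = U(Φ₃)(L⁺_v)` regular with `γ₀ ∉ Ω` the characteristic polynomial over the field
`L_w = L ⊗ L⁺_v` is of exactly one of the three NON-hyperbolic types of [Rogawski1990, §3.6]:
* type (3): `charpoly γ₀` irreducible (cubic Cartan);
* type (2): `charpoly γ₀ = q · (X − u)` with `q` monic irreducible quadratic and `σ(u)·u = 1`;
* type (1): `charpoly γ₀ = ∏ₖ (X − uₖ)`, `u : Fin 3 → L_w` injective, `σ(uₖ)·uₖ = 1` for all `k` — the letters `(hu) (hu1) (hchar)` of ★ F3b `exists_typeOne_memberPackage`.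
§1 at `p := charpoly γ₀` (monic of degree `3`, separable = regular), and every rational root is unitary because an eigenvalue `α` with `α σ(α) ≠ 1` would put `γ₀` in `Ω`
(★ `mul_conjLocal_eq_one_of_not_mem_hyperbolicSet`). [cite: Rogawski1990, §3.6 pp. 28–31; §12.5 p. 182; §3.1 p. 19] -/
theorem charpoly_shape_of_not_mem_hyperbolicSet (hns : ∀ w : PlacesOver L v, IsCMField.complexConj L • w.1 = w.1) (γ₀ : Gqs L v)
    (hreg : IsRegularElt (γ₀.val : GL (Fin 3) (LocalRing L v))) (hΩ : γ₀ ∉ F0P3cStCharTSTorusDefs.hyperbolicSet L v) :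
    Irreducible γ₀.val.val.charpoly ∨
      (∃ (q : (LocalRing L v)[X]) (u : LocalRing L v), Irreducible q ∧ q.Monic ∧ q.natDegree = 2 ∧
          conjLocal L (IsCMField.complexConj L) v u * u = 1 ∧ γ₀.val.val.charpoly = q * (X - C u)) ∨
      (∃ u : Fin 3 → LocalRing L v, Function.Injective u ∧ (∀ k, conjLocal L (IsCMField.complexConj L) v (u k) * u k = 1) ∧
          γ₀.val.val.charpoly = ∏ k, (X - C (u k))) := by
  obtain ⟨w⟩ := (inferInstance : Nonempty (PlacesOver L v))
  letI : Field (LocalRing L v) := (LocalRing.isField_of_smul_eq (IsCMField.complexConj L) (IsCMField.complexConj_ne_one L) w (hns w)).toField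
  -- every rational root of `charpoly γ₀` is unitary (`γ₀ ∉ Ω`)
  have hunit : ∀ u : LocalRing L v, γ₀.val.val.charpoly.IsRoot u → conjLocal L (IsCMField.complexConj L) v u * u = 1 := fun u hu => by
    rw [mul_comm]
    exact F0P3cStCharTSHyperbolicSetEigen.mul_conjLocal_eq_one_of_not_mem_hyperbolicSet L v hns hreg hΩ hu
  have hmonic : γ₀.val.val.charpoly.Monic := Matrix.charpoly_monic _
  have hdeg : γ₀.val.val.charpoly.natDegree = 3 := by
    rw [Matrix.charpoly_natDegree_eq_dim, Fintype.card_fin]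
  have hsep : γ₀.val.val.charpoly.Separable := (isRegularElt_iff _).1 hreg
  rcases cubic_shape_of_monic_separable _ hmonic hdeg hsep with hirr | ⟨q, u, hq, hqm, hq2, hchar⟩ | ⟨u, hu, hchar⟩
  · exact Or.inl hirr
  · exact Or.inr (Or.inl ⟨q, u, hq, hqm, hq2, hunit u (isRoot_of_charpoly_eq_mul_X_sub_C hchar), hchar⟩)
  · exact Or.inr (Or.inr ⟨u, hu, fun k => hunit (u k) (isRoot_of_charpoly_eq_prod hchar k), hchar⟩)

/-! ## §3 On the members of a Cartan system: `Z(γ₀) ∈ C` with `γ₀ ∈ Ω` is `M`; `Z(γ₀) ≠ M` forces `γ₀ ∉ Ω` -/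

/-- **A regular element with COMPACT centraliser is not hyperbolic** (any place), on the `Gqs L v` carrier: ★ S9a `not_mem_hyperbolicSet_of_isCompact_centralizer` (a compact
`Z(γ₀)` conjugate into the non-compact split torus `M` is absurd) read with `t := γ₀`. [cite: Rogawski1990, §12.5 pp. 182–184; §3.6 pp. 28–31] -/
theorem not_mem_hyperbolicSet_of_isCompact_centralizer_gqs {γ₀ : Gqs L v} (hreg : IsRegularElt (γ₀.val : GL (Fin 3) (LocalRing L v)))
    (hcpt : IsCompact ((Subgroup.centralizer ({γ₀} : Set (Gqs L v))) : Set (Gqs L v))) : γ₀ ∉ F0P3cStCharTSTorusDefs.hyperbolicSet L v :=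
  F0P3cStCharTSCartanFields.not_mem_hyperbolicSet_of_isCompact_centralizer L v
    (γ₀ := (γ₀ : ↥(unitaryGroupOfForm (conjLocal L (IsCMField.complexConj L) v) (cmLocalForm L 3 v)))) hreg hcpt
    (t := (γ₀ : ↥(unitaryGroupOfForm (conjLocal L (IsCMField.complexConj L) v) (cmLocalForm L 3 v)))) (Subgroup.mem_centralizer_singleton_iff.2 rfl) hreg

/-- **A MEMBER `T = Z(γ₀)` OF A CARTAN SYSTEM WITH `γ₀ ∈ Ω` IS THE SPLIT TORUS `M`**, for a Cartan system `C` all of whose members other than `M` are compact (binder `hcpt`): were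
`T ≠ M`, `Z(γ₀) = T` would be compact and `γ₀ ∉ Ω` (`not_mem_hyperbolicSet_of_isCompact_centralizer_gqs`).  Any place. [cite: Rogawski1990, §12.5 pp. 182–184; §3.6 pp. 28–31] -/
theorem eq_M_of_mem_hyperbolicSet_of_mem {C : Finset (Subgroup (Gqs L v))}
    (hcpt : ∀ T ∈ C, T ≠ (cmBorelTriple L 3 v).M → IsCompact (T : Set (Gqs L v))) {T : Subgroup (Gqs L v)} (hT : T ∈ C) {γ₀ : Gqs L v}
    (hreg : IsRegularElt (γ₀.val : GL (Fin 3) (LocalRing L v))) (hTZ : T = Subgroup.centralizer ({γ₀} : Set (Gqs L v)))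
    (hΩ : γ₀ ∈ F0P3cStCharTSTorusDefs.hyperbolicSet L v) : T = (cmBorelTriple L 3 v).M := by
  by_contra hne
  have hc : IsCompact ((Subgroup.centralizer ({γ₀} : Set (Gqs L v))) : Set (Gqs L v)) := by
    rw [← hTZ]
    exact hcpt T hT hne
  exact not_mem_hyperbolicSet_of_isCompact_centralizer_gqs hreg hc hΩ

/-- **A MEMBER `T = Z(γ₀) ≠ M` HAS `γ₀ ∉ Ω`** (same Cartan system hypothesis `hcpt`; any place) — the twin of `eq_M_of_mem_hyperbolicSet_of_mem`, the entry to §2's type split.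
[cite: Rogawski1990, §12.5 pp. 182–184; §3.6 pp. 28–31] -/
theorem not_mem_hyperbolicSet_of_ne_M {C : Finset (Subgroup (Gqs L v))}
    (hcpt : ∀ T ∈ C, T ≠ (cmBorelTriple L 3 v).M → IsCompact (T : Set (Gqs L v))) {T : Subgroup (Gqs L v)} (hT : T ∈ C) {γ₀ : Gqs L v}
    (hreg : IsRegularElt (γ₀.val : GL (Fin 3) (LocalRing L v))) (hTZ : T = Subgroup.centralizer ({γ₀} : Set (Gqs L v)))
    (hne : T ≠ (cmBorelTriple L 3 v).M) : γ₀ ∉ F0P3cStCharTSTorusDefs.hyperbolicSet L v :=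
  fun hΩ => hne (eq_M_of_mem_hyperbolicSet_of_mem hcpt hT hreg hTZ hΩ)

end Gqs

end Summit.HodgeConjecture.HodgeConjecture.R90.S4

end
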